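import Summits.QuantumFields.BalabanUV.Beta.D1BFx.RestKernelWords
import Summits.QuantumFields.BalabanUV.Beta.D1BFx.GhostLeg
import Summits.QuantumFields.BalabanUV.Beta.D1BFx.RJetProjector
import Literature.MathematicalPhysics.QuantumFieldTheory.Balaban1983to89.Beta.BalabanStepJetsSucc

/-!
# `BalabanUV.Beta.D1BFx.RestKernelGhostWords` — road «BF-x» for binder row D1, slot (K): **THE GHOST REST KERNELS WORD BY WORD** («RK-GH-WORDS» ∕
# «RK-GH-ABS», the ghost twin of `RestKernelWords`; DICT-CHAIN-SPEC v1.2 §1 (S-GH), §2 row RK-GH, ruling ρ-g15-1 «the sixteen `ghostWord`s are the RK-GH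
# rest kernels … their `AbsMoment₂` … = RK-GH-ABS, claimable right after PART 2b»): the `P`-remainder of GH-DICT PART 2b as TWELVE NAMED word-indexed
# kernels `ghostWord G P V V′ W i` (the sixteen-slot display is redundant by four slots), each a well-typed (1.22)-kernel at base-point families
# (`AbsMoment₂`, per word), the displayed remainder EQUAL to the word sum, and the ROAD INSTANCE at the legs `Ggh n a`, `Pgt n a`

HONEST DEPENDENCY (cell records, verbatim): «continuum YM on T⁴ ⇐ BetaPertH ∧ nine spine estimates (0/9 proved); BetaPertH ⇐ (D1) ∧ (D4) ∧
CAP+tail; G-an2-4 gates asym, D1 and NE2/3/4.»  HONEST FRAMING (cell contract, verbatim): «discharging `BetaPertH` makes Bałaban's UV stability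
UNCONDITIONAL — a real constructive-QFT result; it is NOT the continuum limit and NOT the Clay problem.»  THIS MODULE DISCHARGES NOTHING of the
wall: [folklore] kernel bookkeeping over leaf-03's `PackedKernelSplitBounds` (`decay510_tadpoleWord` ∕ `decay510_biBubbleWord`), an2's
`BalabanStepJetsSucc.decays_comp`, `DecimatedMomentSummable.absMoment₂_of_decay510`, `StepDriftWitness.absMoment₂_finset_sum_gen`, this lineage's
`RestKernelWords.secondMoment_eq_sum_of_pointwise`, the typer's `GhostLeg.decays_Ggh` and leaf-05's `RJetProjector.decays_Pgt`, plus ONE small [our object]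
DATA definition (`ghostWord` — the words, coefficients folded in; asserting nothing).  No `def … : Prop`, nothing cited, 0 sorry.  NO n-uniform bound, NO
unit-class row: the constants are per `n`; the RK-GH unit rows (ρ-g11-9, physical weight) remain OPEN.  0 root-level binders of row D1 discharged;
(K) NOT closed; NOT D1, NOT `BetaPertH`, NOT continuum, NOT Clay.

ABSOLUTE RULE (cell charter, verbatim): «No internally-minted statement may enter as a cited fact. Every hypothesis is either kernel-proved in
this package or a verbatim quotation of a PUBLISHED theorem with page reference. The manuscript(s) under audit are NOT citable for their own
disputed steps — they are the thing under adjudication; programme-internal (2001/route/tribunal) claims are never citable.»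

WHY.  GH-DICT PART 2b (leaf-04 lineage: `GhostSqrtLeg.eightWords_split` p307400, `GhostSqrtLegFib`, `GhostSqrtLegLimit`) reads the ghost slot of (A1)
on `ℤ⁴` as `2·hessKer (Ggh n a) (n²•𝒱) (n²•𝒲) μ ν z` MINUS a `P`-remainder DISPLAYED in the sixteen-slot layout of `eightWords_split`:
`½·(tr(PG·W) + tr(GP·W) + tr(GPG·V·V′) + tr(GPG·V′·V)) − ½·(eight single-P bubble slots) + ½·(four double-P bubble slots)`.  FINDING F-d1leaf01-g20-1
(journal): the two `V·V′`-table slots of the first group ARE the 4th and 5th slots of the second group (on the torus by associativity ∕ trace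
cyclicity; on `ℤ⁴` the displayed terms are syntactically identical) and CANCEL — the remainder is TWELVE words, none of the identity-leg class.  This
file names them (§1), proves the displayed sixteen-slot remainder IS their sum (§1, `ring`), types each as a (1.22)-kernel at base-point families
(§2 — `hMR` of the (K) row discharged per ghost word: «RK-GH-ABS»), and instantiates at the road's ghost legs (§3).  The unit-class estimates
RK-GH then plug in word by word, exactly as RK-SAND ∕ RK-BLK plug into `RestKernelWords`.

CONTENT (generic dimension `D`, fibre `F`; legs `G P : MKer D F`; jets `V V′ W : MKer D F`).
* §1 [our object] **`ghostWord G P V V′ W : GhIdx → ℝ`**, `GhIdx := Bool ⊕ (Option Bool × Bool) ⊕ (Bool ⊕ Bool)` (2 tadpoles ∣ 3 single-P leg pairs ×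
  order ∣ 2 + 2 double-P words; table in the docstring); [folklore] **`pRem_sixteen_eq_sum_ghostWord`** (the sixteen-slot display `= Σ_i ghostWord … i`).
* §2 [folklore] base-point form `ghostWordK G P 𝒱 𝒲 i μ ν z := ghostWord G P (𝒱 μ 0) (𝒱 ν z) (𝒲 μ 0 ν z) i`; **`absMoment₂_ghostWordK`** (`Decays G`, `Decays P`
  at a common positive rate, `VertexFamily 𝒱 N`, `VertexFamily₂ 𝒲 N`, `1 ≤ N` ⊢ every word, every channel); **`absMoment₂_sum_ghostWordK`**;
  **`secondMoment_eq_sum_ghostWordK`** (a channel that is pointwise the displayed remainder has (1.22) moment `= Σ_i` word moments).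
* §3 [folklore] ROAD INSTANCE (`0 < a`, block side `n ≥ 1`): **`absMoment₂_ghostWordK_road`** at `G := Ggh n a`, `P := Pgt n a` for ANY base-point families
  at blocking `N ≥ 1` (the `n²`-rescaled jets of PART 2b are such families: `vertexFamily_smul` ∕ `vertexFamily₂_smul`).
NOT HERE (honest): the comparison with `PghQ` (GH-DICT PART 3), any n-uniform ∕ physical-weight bound (RK-GH unit rows), the junction `example` with
`GhostSqrtLegLimit` (X-read probe when that file lands — this module does not import it).
Unit `b2b-balaban-beta-d1-formalise-leaf-01` (gen 20), D1 formalisation swarm leaf prover 01, road «BF-x»; INTENT 1 «RK-GH-WORDS» (journal).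
-/

noncomputable section

open Finset
open scoped BigOperators
open Literature.MathematicalPhysics.QuantumFieldTheory.Balaban1983to89
open Literature.MathematicalPhysics.QuantumFieldTheory.Balaban1983to89.Beta
open B12Sec2to5 (l1 Decay510)
open ExpKernelCalculus (Site MKer Decays BiLoc VertexFamily VertexFamily₂ comp tr tadpole bubble hessKer)
open DecimatedMomentSummable (AbsMoment₂ absMoment₂_of_decay510)
open StepDriftWitness (absMoment₂_zero_gen absMoment₂_finset_sum_gen)
open HessianTelescopingKKT (absMoment₂_const_mul')
open BalabanStepJetsSucc (decays_comp)
open Summit.QuantumFields.BalabanUV.Beta.TameKernelCalculus (decays_of_le biLoc_of_le)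
open Summit.QuantumFields.BalabanUV.Beta.D1BFx.PackedKernelSplit (biBubble)
open Summit.QuantumFields.BalabanUV.Beta.D1BFx.PackedKernelSplitBounds (decay510_tadpoleWord decay510_biBubbleWord)
open Summit.QuantumFields.BalabanUV.Beta.D1BFx.RestKernelWords (secondMoment_eq_sum_of_pointwise)
open Summit.QuantumFields.BalabanUV.Beta.D1BFx.GhostKernel (biLoc_smul')
open Summit.QuantumFields.BalabanUV.Beta.D1BFx.RProjector (Pgt deltaPP deltaPP_pos)
open Summit.QuantumFields.BalabanUV.Beta.D1BFx.RJetProjector (decays_Pgt)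
open Summit.QuantumFields.BalabanUV.Beta.D1BFx.GhostLeg (Ggh decays_Ggh)
open B6QGQDecay237 (deltaU deltaU_pos)

namespace Summit.QuantumFields.BalabanUV.Beta.D1BFx.RestKernelGhostWords

/-- [our object] The word index of the ghost `P`-remainder: `inl b` — the two TADPOLE words (`b = false`: leg `P∘G`; `b = true`: leg `G∘P`);
`inr (inl (π, s))` — the six SINGLE-`P` bubble words, `π` the leg pair (`none`: `(G∘G, P)`; `some false`: `(G, P∘G)`; `some true`: `(G, G∘P)`),
`s` the order (`false`: first leg against `V`, second against `V′`; `true`: swapped); `inr (inr (inl b))` — the DOUBLE-`P` self-pairs (`false`: `(P∘G, P∘G)`;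
`true`: `(G∘P, G∘P)`); `inr (inr (inr b))` — the DOUBLE-`P` mixed pair (`false`: `(G∘P∘G, P)`; `true`: `(P, G∘P∘G)`). -/
abbrev GhIdx : Type := Bool ⊕ (Option Bool × Bool) ⊕ (Bool ⊕ Bool)

/-! ## §1 The twelve ghost rest words -/

section Words

variable {D : ℕ} {F : Type*} [Fintype F]

/-- [our object] The first leg of the single-`P` pair `π` (it never carries `P`). -/
def pairLegL (G : MKer D F) : Option Bool → MKer D F
  | none => comp G G
  | some false => G
  | some true => G

/-- [our object] The second leg of the single-`P` pair `π`. -/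
def pairLegR (G P : MKer D F) : Option Bool → MKer D F
  | none => P
  | some false => comp P G
  | some true => comp G P

/-- [our object] **THE TWELVE GHOST REST WORDS** of GH-DICT PART 2b's `P`-remainder, coefficients `±½` folded in (table: see `GhIdx`):
tadpoles `½·tadpole (P∘G) W`, `½·tadpole (G∘P) W`; single-`P` bubbles `−½·biBubble L₁ V L₂ V′` over the three leg pairs in both orders; double-`P` bubbles
`+½·biBubble L V L V′` for `L ∈ {P∘G, G∘P}` and `+½·biBubble (G∘P∘G) V P V′`, `+½·biBubble P V (G∘P∘G) V′`.  A DEFINITION; asserts nothing. -/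
def ghostWord (G P V V' W : MKer D F) : GhIdx → ℝ
  | Sum.inl b => (1 / 2) * tadpole (bif b then comp G P else comp P G) W
  | Sum.inr (Sum.inl (π, s)) =>
      -(1 / 2) * bif s then biBubble (pairLegR G P π) V (pairLegL G π) V' else biBubble (pairLegL G π) V (pairLegR G P π) V'
  | Sum.inr (Sum.inr (Sum.inl b)) =>
      (1 / 2) * bif b then biBubble (comp G P) V (comp G P) V' else biBubble (comp P G) V (comp P G) V'
  | Sum.inr (Sum.inr (Sum.inr b)) =>
      (1 / 2) * bif b then biBubble P V (comp G (comp P G)) V' else biBubble (comp G (comp P G)) V P V'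

/-- [folklore] **THE SIXTEEN-SLOT `P`-REMAINDER OF GH-DICT PART 2b IS THE SUM OF THE TWELVE WORDS** (the display of
`GhostSqrtLegLimit.tendsto_hessT_Cgh_biLaplacian` with generic jets `V V′ W`; the two `V·V′`-table slots of the first group cancel the 4th∕5th slots of
the second group — FINDING F-d1leaf01-g20-1 — and the rest is re-indexed; `ring`). -/
theorem pRem_sixteen_eq_sum_ghostWord (G P V V' W : MKer D F) :
    (1 / 2) * (tr (comp (comp P G) W) + tr (comp (comp G P) W) + tr (comp (comp (comp G (comp P G)) V) V')
          + tr (comp (comp (comp G (comp P G)) V') V))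
      - (1 / 2) * (tr (comp (comp G V) (comp (comp P G) V')) + tr (comp (comp (comp P G) V) (comp G V'))
          + tr (comp (comp (comp G G) V) (comp P V')) + tr (comp (comp (comp G (comp P G)) V) V')
          + tr (comp (comp (comp G (comp P G)) V') V) + tr (comp (comp P V) (comp (comp G G) V'))
          + tr (comp (comp G V) (comp (comp G P) V')) + tr (comp (comp (comp G P) V) (comp G V')))
      + (1 / 2) * (tr (comp (comp (comp P G) V) (comp (comp P G) V')) + tr (comp (comp (comp G (comp P G)) V) (comp P V'))
          + tr (comp (comp P V) (comp (comp G (comp P G)) V')) + tr (comp (comp (comp G P) V) (comp (comp G P) V')))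
      = ∑ i, ghostWord G P V V' W i := by
  simp only [ghostWord, pairLegL, pairLegR, biBubble, tadpole, Fintype.sum_sum_type, Fintype.sum_prod_type, Fintype.sum_bool,
    Fintype.sum_option, cond_true, cond_false]
  ring

end Words

/-! ## §2 Base-point families: every ghost word is a well-typed (1.22)-kernel -/

section Families

variable {D : ℕ} {F : Type*} [Fintype F]

/-- [our object] **THE GHOST WORDS AT BASE-POINT FAMILIES**: `ghostWordK G P 𝒱 𝒲 i μ ν z := ghostWord G P (𝒱 μ 0) (𝒱 ν z) (𝒲 μ 0 ν z) i`
(first jets at the base bond `(μ, 0)` and the running bond `(ν, z)`, mixed second jet between them). -/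
def ghostWordK (G P : MKer D F) (𝒱 : Fin D → Site D → MKer D F) (𝒲 : Fin D → Site D → Fin D → Site D → MKer D F) (i : GhIdx)
    (μ ν : Fin D) : Site D → ℝ :=
  fun z => ghostWord G P (𝒱 μ 0) (𝒱 ν z) (𝒲 μ 0 ν z) i

/-- [our object] Unfolding `ghostWordK`. -/
theorem ghostWordK_apply (G P : MKer D F) (𝒱 : Fin D → Site D → MKer D F) (𝒲 : Fin D → Site D → Fin D → Site D → MKer D F)
    (i : GhIdx) (μ ν : Fin D) (z : Site D) : ghostWordK G P 𝒱 𝒲 i μ ν z = ghostWord G P (𝒱 μ 0) (𝒱 ν z) (𝒲 μ 0 ν z) i := rfl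

omit [Fintype F] in
/-- [folklore] Scaling a first-order vertex family scales its constant (same rate, same blocking). -/
theorem vertexFamily_smul {𝒱 : Fin D → Site D → MKer D F} {N : ℕ} {Cv δ : ℝ} (c : ℝ) (hV : VertexFamily 𝒱 N Cv δ) :
    VertexFamily (fun μ y => c • 𝒱 μ y) N (|c| * Cv) δ :=
  fun μ y => biLoc_smul' c (hV μ y)

omit [Fintype F] in
/-- [folklore] Scaling a second-order vertex family scales its constant (same rate, same blocking). -/
theorem vertexFamily₂_smul {𝒲 : Fin D → Site D → Fin D → Site D → MKer D F} {N : ℕ} {Cw δ : ℝ} (c : ℝ) (hW : VertexFamily₂ 𝒲 N Cw δ) :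
    VertexFamily₂ (fun μ y ν y' => c • 𝒲 μ y ν y') N (|c| * Cw) δ :=
  fun μ y ν y' => biLoc_smul' c (hW μ y ν y')

/-- [folklore] **EVERY GHOST REST WORD IS A WELL-TYPED (1.22)-KERNEL**: for legs `G`, `P` decaying at a common rate `δ > 0` and base-point families `𝒱`
(first order) and `𝒲` (second order) at blocking `N ≥ 1` with the same rate, every channel `(μ, ν)` of every ghost word has absolutely summable second
moments.  The composite legs `P∘G`, `G∘P`, `G∘G` decay at rate `δ∕2` and `G∘P∘G` at rate `δ∕4` (`decays_comp`); everything is brought to the common rate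
`δ∕4` by monotonicity, then leaf-03's `decay510_tadpoleWord` ∕ `decay510_biBubbleWord` and `absMoment₂_of_decay510`. -/
theorem absMoment₂_ghostWordK {G P : MKer D F} {𝒱 : Fin D → Site D → MKer D F} {𝒲 : Fin D → Site D → Fin D → Site D → MKer D F}
    {CG CP Cv Cw δ : ℝ} {N : ℕ} (hG : Decays G CG δ) (hP : Decays P CP δ) (hδ : 0 < δ) (hV : VertexFamily 𝒱 N Cv δ)
    (hW : VertexFamily₂ 𝒲 N Cw δ) (hN : 1 ≤ N) (i : GhIdx) (μ ν : Fin D) :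
    AbsMoment₂ (ghostWordK G P 𝒱 𝒲 i μ ν) := by
  -- composite legs
  have hδ2 : 0 < δ / 2 := half_pos hδ
  have hδ4 : 0 < δ / 4 := by linarith
  have h2lt : δ / 2 < δ := half_lt_self hδ
  have hPG := decays_comp hP hG hδ2.le h2lt
  have hGP := decays_comp hG hP hδ2.le h2lt
  have hGG := decays_comp hG hG hδ2.le h2lt
  have hG2 : Decays G (|CG|) (δ / 2) := decays_of_le hG h2lt.le
  have hGPG := decays_comp hG2 hPG (show (0 : ℝ) ≤ δ / 4 by linarith) (show δ / 4 < δ / 2 by linarith)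
  -- everything at the common rate `δ / 4`
  have h4le : δ / 4 ≤ δ := by linarith
  have h4le2 : δ / 4 ≤ δ / 2 := by linarith
  have hG4 := decays_of_le hG h4le
  have hP4 := decays_of_le hP h4le
  have hPG4 := decays_of_le hPG h4le2
  have hGP4 := decays_of_le hGP h4le2
  have hGG4 := decays_of_le hGG h4le2
  have hGPG4 := decays_of_le hGPG (le_refl (δ / 4))
  have hV4 : VertexFamily 𝒱 N (|Cv|) (δ / 4) := fun μ' y => biLoc_of_le (hV μ' y) h4le
  have hW4 : VertexFamily₂ 𝒲 N (|Cw|) (δ / 4) := fun μ' y ν' y' => biLoc_of_le (hW μ' y ν' y') h4le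
  -- the legs of the single-`P` pairs decay at the common rate
  have hL : ∀ π : Option Bool, ∃ C, Decays (pairLegL G π) C (δ / 4) := fun π => by
    rcases π with _ | (_ | _)
    · exact ⟨_, hGG4⟩
    · exact ⟨_, hG4⟩
    · exact ⟨_, hG4⟩
  have hR : ∀ π : Option Bool, ∃ C, Decays (pairLegR G P π) C (δ / 4) := fun π => by
    rcases π with _ | (_ | _)
    · exact ⟨_, hP4⟩
    · exact ⟨_, hPG4⟩
    · exact ⟨_, hGP4⟩
  -- a bubble word with two legs at the common rate is a (1.22)-kernel, and so is a tadpole word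
  have bub : ∀ {A B : MKer D F} {CA CB : ℝ}, Decays A CA (δ / 4) → Decays B CB (δ / 4) →
      AbsMoment₂ (fun z => biBubble A (𝒱 μ 0) B (𝒱 ν z)) := fun hA hB =>
    absMoment₂_of_decay510 (by linarith) (decay510_biBubbleWord hA hB hV4 hV4 hδ4 hN μ ν)
  have tad : ∀ {A : MKer D F} {CA : ℝ}, Decays A CA (δ / 4) → AbsMoment₂ (fun z => tadpole A (𝒲 μ 0 ν z)) := fun hA =>
    absMoment₂_of_decay510 (by linarith) (decay510_tadpoleWord hA hW4 hδ4 hN μ ν)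
  rcases i with b | ⟨π, s⟩ | (b | b)
  · cases b
    · unfold ghostWordK; simp only [ghostWord, cond_false]; exact absMoment₂_const_mul' (tad hPG4) _
    · unfold ghostWordK; simp only [ghostWord, cond_true]; exact absMoment₂_const_mul' (tad hGP4) _
  · obtain ⟨CL, hl⟩ := hL π
    obtain ⟨CR, hr⟩ := hR π
    cases s
    · unfold ghostWordK; simp only [ghostWord, cond_false]; exact absMoment₂_const_mul' (bub hl hr) _
    · unfold ghostWordK; simp only [ghostWord, cond_true]; exact absMoment₂_const_mul' (bub hr hl) _
  · cases b
    · unfold ghostWordK; simp only [ghostWord, cond_false]; exact absMoment₂_const_mul' (bub hPG4 hPG4) _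
    · unfold ghostWordK; simp only [ghostWord, cond_true]; exact absMoment₂_const_mul' (bub hGP4 hGP4) _
  · cases b
    · unfold ghostWordK; simp only [ghostWord, cond_false]; exact absMoment₂_const_mul' (bub hGPG4 hP4) _
    · unfold ghostWordK; simp only [ghostWord, cond_true]; exact absMoment₂_const_mul' (bub hP4 hGPG4) _

/-- [folklore] **THE WHOLE `P`-REMAINDER CHANNEL IS A WELL-TYPED (1.22)-KERNEL** (finite sum of the twelve words). -/
theorem absMoment₂_sum_ghostWordK {G P : MKer D F} {𝒱 : Fin D → Site D → MKer D F} {𝒲 : Fin D → Site D → Fin D → Site D → MKer D F}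
    {CG CP Cv Cw δ : ℝ} {N : ℕ} (hG : Decays G CG δ) (hP : Decays P CP δ) (hδ : 0 < δ) (hV : VertexFamily 𝒱 N Cv δ)
    (hW : VertexFamily₂ 𝒲 N Cw δ) (hN : 1 ≤ N) (μ ν : Fin D) :
    AbsMoment₂ (fun z => ∑ i, ghostWordK G P 𝒱 𝒲 i μ ν z) :=
  absMoment₂_finset_sum_gen _ fun i _ => absMoment₂_ghostWordK hG hP hδ hV hW hN i μ ν

/-- [folklore] **THE (1.22) MOMENT OF THE `P`-REMAINDER CHANNEL IS THE SUM OF THE TWELVE WORD MOMENTS**: if the `(μ, ν)` channel of `T` is, entry by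
entry, the sixteen-slot remainder of GH-DICT PART 2b at the base-point families (equivalently `Σ_i ghostWordK … i μ ν z`, §1), then
`secondMoment T μ ν = Σ_i secondMoment (ghostWordK G P 𝒱 𝒲 i) μ ν`. -/
theorem secondMoment_eq_sum_ghostWordK {G P : MKer D F} {𝒱 : Fin D → Site D → MKer D F} {𝒲 : Fin D → Site D → Fin D → Site D → MKer D F}
    {CG CP Cv Cw δ : ℝ} {N : ℕ} (hG : Decays G CG δ) (hP : Decays P CP δ) (hδ : 0 < δ) (hV : VertexFamily 𝒱 N Cv δ)
    (hW : VertexFamily₂ 𝒲 N Cw δ) (hN : 1 ≤ N) {T : Fin D → Fin D → Site D → ℝ} {μ ν : Fin D}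
    (hT : ∀ z, T μ ν z = ∑ i, ghostWordK G P 𝒱 𝒲 i μ ν z) :
    B12Beta.secondMoment T μ ν = ∑ i, B12Beta.secondMoment (ghostWordK G P 𝒱 𝒲 i) μ ν :=
  secondMoment_eq_sum_of_pointwise hT fun i => absMoment₂_ghostWordK hG hP hδ hV hW hN i μ ν

/-- [folklore] The sixteen-slot remainder AT BASE-POINT FAMILIES is, entry by entry, the sum of the twelve family words (§1 read at
`V := 𝒱 μ 0`, `V′ := 𝒱 ν z`, `W := 𝒲 μ 0 ν z`) — the `hT` of `secondMoment_eq_sum_ghostWordK` for the displayed remainder. -/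
theorem pRemK_sixteen_eq_sum_ghostWordK (G P : MKer D F) (𝒱 : Fin D → Site D → MKer D F)
    (𝒲 : Fin D → Site D → Fin D → Site D → MKer D F) (μ ν : Fin D) (z : Site D) :
    (1 / 2) * (tr (comp (comp P G) (𝒲 μ 0 ν z)) + tr (comp (comp G P) (𝒲 μ 0 ν z)) + tr (comp (comp (comp G (comp P G)) (𝒱 μ 0)) (𝒱 ν z))
          + tr (comp (comp (comp G (comp P G)) (𝒱 ν z)) (𝒱 μ 0)))
      - (1 / 2) * (tr (comp (comp G (𝒱 μ 0)) (comp (comp P G) (𝒱 ν z))) + tr (comp (comp (comp P G) (𝒱 μ 0)) (comp G (𝒱 ν z)))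
          + tr (comp (comp (comp G G) (𝒱 μ 0)) (comp P (𝒱 ν z))) + tr (comp (comp (comp G (comp P G)) (𝒱 μ 0)) (𝒱 ν z))
          + tr (comp (comp (comp G (comp P G)) (𝒱 ν z)) (𝒱 μ 0)) + tr (comp (comp P (𝒱 μ 0)) (comp (comp G G) (𝒱 ν z)))
          + tr (comp (comp G (𝒱 μ 0)) (comp (comp G P) (𝒱 ν z))) + tr (comp (comp (comp G P) (𝒱 μ 0)) (comp G (𝒱 ν z))))
      + (1 / 2) * (tr (comp (comp (comp P G) (𝒱 μ 0)) (comp (comp P G) (𝒱 ν z)))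
          + tr (comp (comp (comp G (comp P G)) (𝒱 μ 0)) (comp P (𝒱 ν z)))
          + tr (comp (comp P (𝒱 μ 0)) (comp (comp G (comp P G)) (𝒱 ν z))) + tr (comp (comp (comp G P) (𝒱 μ 0)) (comp (comp G P) (𝒱 ν z))))
      = ∑ i, ghostWordK G P 𝒱 𝒲 i μ ν z :=
  pRem_sixteen_eq_sum_ghostWord G P (𝒱 μ 0) (𝒱 ν z) (𝒲 μ 0 ν z)

end Families

/-! ## §3 Road instance: the ghost legs `Ggh n a`, `Pgt n a` -/

section Road

variable (n : ℕ) [NeZero n] {a : ℝ}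

/-- [folklore] **GHOST REST WORDS OVER THE ROAD's GHOST LEGS**: for `0 < a` and ANY base-point families at blocking `N ≥ 1` localised at the common ghost rate
`min (δ_U∕4n) (δ_PP∕4n)` (`GhostLeg.decays_Ggh`, `RJetProjector.decays_Pgt`; a family at a larger rate is such a family by `biLoc_of_le`), every ghost word of
GH-DICT PART 2b's remainder at `G := Ggh n a`, `P := Pgt n a` is a well-typed (1.22)-kernel — the `hMR` row of the (K) dictionary for the RK-GH kernels. -/
theorem absMoment₂_ghostWordK_road (ha : 0 < a) {𝒱 : Fin 4 → Site 4 → MKer 4 Unit} {𝒲 : Fin 4 → Site 4 → Fin 4 → Site 4 → MKer 4 Unit}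
    {Cv Cw : ℝ} {N : ℕ} (hV : VertexFamily 𝒱 N Cv (min (deltaU 4 a / (4 * n)) (deltaPP 4 a / (4 * n))))
    (hW : VertexFamily₂ 𝒲 N Cw (min (deltaU 4 a / (4 * n)) (deltaPP 4 a / (4 * n)))) (hN : 1 ≤ N) (i : GhIdx) (μ ν : Fin 4) :
    AbsMoment₂ (ghostWordK (Ggh n a) (Pgt n a) 𝒱 𝒲 i μ ν) := by
  have h4 : 0 < 4 * (n : ℝ) := mul_pos four_pos (Nat.cast_pos.2 (Nat.pos_of_ne_zero (NeZero.ne n)))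
  have hm : 0 < min (deltaU 4 a / (4 * n)) (deltaPP 4 a / (4 * n)) := lt_min (div_pos (deltaU_pos 4 ha) h4) (div_pos (deltaPP_pos 4 ha) h4)
  exact absMoment₂_ghostWordK (decays_of_le (decays_Ggh n a ha) (min_le_left _ _)) (decays_of_le (decays_Pgt n a ha) (min_le_right _ _)) hm hV hW hN i μ ν

/-- [folklore] The same for families given at ANY positive rate `δ`: the words are (1.22)-kernels (bring legs and families to the common rate
`min δ (min (δ_U∕4n) (δ_PP∕4n))`). -/
theorem absMoment₂_ghostWordK_road' (ha : 0 < a) {𝒱 : Fin 4 → Site 4 → MKer 4 Unit} {𝒲 : Fin 4 → Site 4 → Fin 4 → Site 4 → MKer 4 Unit}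
    {Cv Cw δ : ℝ} {N : ℕ} (hV : VertexFamily 𝒱 N Cv δ) (hW : VertexFamily₂ 𝒲 N Cw δ) (hδ : 0 < δ) (hN : 1 ≤ N) (i : GhIdx) (μ ν : Fin 4) :
    AbsMoment₂ (ghostWordK (Ggh n a) (Pgt n a) 𝒱 𝒲 i μ ν) := by
  have h4 : 0 < 4 * (n : ℝ) := mul_pos four_pos (Nat.cast_pos.2 (Nat.pos_of_ne_zero (NeZero.ne n)))
  set δ₀ : ℝ := min δ (min (deltaU 4 a / (4 * n)) (deltaPP 4 a / (4 * n))) with hδ₀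
  have hm : 0 < δ₀ := lt_min hδ (lt_min (div_pos (deltaU_pos 4 ha) h4) (div_pos (deltaPP_pos 4 ha) h4))
  have hG := decays_of_le (decays_Ggh n a ha) ((min_le_right _ _).trans (min_le_left _ _) : δ₀ ≤ _)
  have hP := decays_of_le (decays_Pgt n a ha) ((min_le_right _ _).trans (min_le_right _ _) : δ₀ ≤ _)
  have hV' : VertexFamily 𝒱 N (|Cv|) δ₀ := fun μ' y => biLoc_of_le (hV μ' y) (min_le_left _ _)
  have hW' : VertexFamily₂ 𝒲 N (|Cw|) δ₀ := fun μ' y ν' y' => biLoc_of_le (hW μ' y ν' y') (min_le_left _ _)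
  exact absMoment₂_ghostWordK hG hP hm hV' hW' hN i μ ν

/-- [folklore] **THE `n²`-RESCALED JETS OF PART 2b**: for families `𝒱`, `𝒲` at any positive rate and blocking `N ≥ 1`, every ghost word at the rescaled
families `n²•𝒱`, `n²•𝒲` over the road's ghost legs is a (1.22)-kernel (the display of `GhostSqrtLegLimit.tendsto_hessT_Cgh_biLaplacian_family`). -/
theorem absMoment₂_ghostWordK_road_rescaled (ha : 0 < a) {𝒱 : Fin 4 → Site 4 → MKer 4 Unit}
    {𝒲 : Fin 4 → Site 4 → Fin 4 → Site 4 → MKer 4 Unit} {Cv Cw δ : ℝ} {N : ℕ} (hV : VertexFamily 𝒱 N Cv δ) (hW : VertexFamily₂ 𝒲 N Cw δ)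
    (hδ : 0 < δ) (hN : 1 ≤ N) (i : GhIdx) (μ ν : Fin 4) :
    AbsMoment₂ (ghostWordK (Ggh n a) (Pgt n a) (fun κ u => ((n : ℝ) ^ 2) • 𝒱 κ u) (fun κ u l u' => ((n : ℝ) ^ 2) • 𝒲 κ u l u') i μ ν) :=
  absMoment₂_ghostWordK_road' n ha (vertexFamily_smul _ hV) (vertexFamily₂_smul _ hW) hδ hN i μ ν

end Road

end Summit.QuantumFields.BalabanUV.Beta.D1BFx.RestKernelGhostWords

end
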